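import Mathlib
import HarnessLib

/-!
# GapsEvoDoors — the Montgomery–Taylor cosine majorant (definitions)

Objects posited by route `GapsEvoDoors` for its door-(a″) certificate of record
`MultCertificateRecord` (item stmt-RiemannHypothesis-23131; window `Δ = 53/50`): the classical
Montgomery–Taylor test pair, i.e. the Paley–Wiener square `g = |𝓕ĥ|²` of the cosine bump
`ĥ(x) = cos(πx/2)·𝟙_{|x| ≤ Δ/2}` (Montgomery 1973 §3 with Taylor's optimisation; Cheer–Goldston
1993: at `Δ = 1` this family gives `N* ≤ (1.3275 + o(1))N`). Here the frequency `c = π/2` is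
fixed so that every angle in the certificate is `π/4`, `π/2` up to the small angles `3π/200`,
`3π/100`. Closed forms (proved in the companion files, not here):
`𝓕ĥ(u) = h(u) = (Δ/2)(sinc((π/2 − 2πu)Δ/2) + sinc((π/2 + 2πu)Δ/2))` (`mtProfile`),
`(ĥ ∗ ĥ)(α) = G(α) = ½(Δ − |α|)cos(π|α|/2) + sin(π(Δ − |α|)/2)/π` on `|α| ≤ Δ`, `0` beyond
(`mtAuto`), and the majorant `g = h²/h(0)²` (`mtMajorant`) with `ĝ = G/h(0)²`, `g ≥ 0`, `g(0) = 1`,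
`supp ĝ ⊆ [−Δ, Δ]`; numerically `m(g; 53/50, 0) = 1.29014`, below both cell engines' class optima
(1.29048 SOS / 1.29290 HGM, whose bases vanish at `±Δ/2`). Definitions only; nothing here bears on
the truth of RH.
-/

noncomputable section

open Real

set_option linter.dupNamespace false  -- the mandated namespace repeats `RiemannHypothesis`

namespace Summit.RiemannHypothesis.RiemannHypothesis.Theorems.GapsEvoDoorsMT

/-- The Montgomery–Taylor cosine bump `ĥ(x) = cos(πx/2)` for `|x| ≤ 53/100`, `0` otherwise
(frequency `π/2`, half-width `Δ/2 = 53/100`). -/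
def mtBump (x : ℝ) : ℝ :=
  if |x| ≤ 53 / 100 then Real.cos (π / 2 * x) else 0

/-- Its Fourier (cosine) transform in closed form,
`h(u) = ∫_{−53/100}^{53/100} cos(πx/2) cos(2πux) dx = (53/100)(sinc((π/2 − 2πu)·53/100) + sinc((π/2 + 2πu)·53/100))`. -/
def mtProfile (u : ℝ) : ℝ :=
  53 / 100 * (Real.sinc ((π / 2 - 2 * π * u) * (53 / 100)) + Real.sinc ((π / 2 + 2 * π * u) * (53 / 100)))

/-- The autocorrelation `G = ĥ ∗ ĥ` in closed form:
`G(α) = ½(53/50 − |α|) cos(π|α|/2) + sin(π(53/50 − |α|)/2)/π` for `|α| ≤ 53/50`, `0` otherwise. -/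
def mtAuto (α : ℝ) : ℝ :=
  if |α| ≤ 53 / 50 then
    (53 / 50 - |α|) / 2 * Real.cos (π / 2 * |α|) + Real.sin (π / 2 * (53 / 50 - |α|)) / π
  else 0

/-- The Montgomery–Taylor majorant `g(u) = h(u)²/h(0)²` (`g ≥ 0`, `g(0) = 1`, `ĝ = G/h(0)²`
supported in `[−53/50, 53/50]`). -/
def mtMajorant (u : ℝ) : ℝ :=
  mtProfile u ^ 2 / mtProfile 0 ^ 2

end Summit.RiemannHypothesis.RiemannHypothesis.Theorems.GapsEvoDoorsMT

end
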